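import Literature.Combinatorics.Sahi2008.Functional
import HarnessLib

/-!
# `NoHeavyLowerTail` (crux stmt-CriticalPhenomena-4575), Sahi programme P4 — DEFINITION of the hypothesis package `H₄⁺`

Definitions file (cell `prim-l12`, seat P4, generation 38; `--supports stmt-CriticalPhenomena-4575`).  No theorems, no sorries.

`H4Plus μ a` collects, for a weight `μ` on a finite type `γ` and a quadruple `a : Fin 4 → γ → ℝ`, the eleven "genuinely higher" rows of the
`H₄⁺`-closure programme (seat memos of generations 33–38): Sahi's `E₃ ≥ 0` [Sahi2008, eq. (7); LiebSahi2021, Def. 3.1] for the four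
sub-triples, the six ORDER-3 PRODUCT ROWS `E₃(a_ia_j, a_k, a_l) ≥ 0` and `E₄(a) ≥ 0`.  On a lattice with an FKG weight and monotone `a` all eleven
are instances of Sahi's conjectured `C₃`, `C₄`; the remaining rows of the programme (Venn atoms, masses, hereditary Harris rows in hold and fail
form) follow from `[0,1]`-valuedness and positive association and are NOT part of the package.  The point of the package: it is CLOSED under
the member-wise OR with an independent Sahi-3-positive monotone block feeding at most three of the four members (`…SahiH4PlusOrThree`), so it
can be iterated over read-once unions.  HONEST FRAMING: a bookkeeping predicate; nothing here is Sahi's conjecture itself.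
`H4Plus` is a PREDICATE with parameters (weight, family), not a named fact. [this work]
-/

namespace Summit.CriticalPhenomena.PercolationContinuityZ3.Theorems.SahiH4Plus

open Literature.Combinatorics.Sahi2008

/-- The package `H₄⁺(μ; a)`: `E₃ ≥ 0` on the four sub-triples of `a = (a₀,a₁,a₂,a₃)`, the six order-3 product rows
`E₃(a_ia_j, a_k, a_l) ≥ 0` (pair written first, the two singles in increasing order), and `E₄(a) ≥ 0`
[Sahi2008, eq. (7); LiebSahi2021, Def. 3.1]. [this work] -/
structure H4Plus {γ : Type*} [Fintype γ] (μ : γ → ℝ) (a : Fin 4 → γ → ℝ) : Prop where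
  e3_012 : 0 ≤ sahiE μ 3 ![a 0, a 1, a 2]
  e3_013 : 0 ≤ sahiE μ 3 ![a 0, a 1, a 3]
  e3_023 : 0 ≤ sahiE μ 3 ![a 0, a 2, a 3]
  e3_123 : 0 ≤ sahiE μ 3 ![a 1, a 2, a 3]
  p3_01 : 0 ≤ sahiE μ 3 ![a 0 * a 1, a 2, a 3]
  p3_02 : 0 ≤ sahiE μ 3 ![a 0 * a 2, a 1, a 3]
  p3_12 : 0 ≤ sahiE μ 3 ![a 1 * a 2, a 0, a 3]
  p3_03 : 0 ≤ sahiE μ 3 ![a 0 * a 3, a 1, a 2]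
  p3_13 : 0 ≤ sahiE μ 3 ![a 1 * a 3, a 0, a 2]
  p3_23 : 0 ≤ sahiE μ 3 ![a 2 * a 3, a 0, a 1]
  e4 : 0 ≤ sahiE μ 4 a

end Summit.CriticalPhenomena.PercolationContinuityZ3.Theorems.SahiH4Plus
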